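import Mathlib.LinearAlgebra.Dimension.Constructions
import Literature.NumberTheory.Transcendental.MultipleZetaStuffle
import Literature.NumberTheory.Transcendental.MultipleZetaEulerProofs
import Literature.NumberTheory.Transcendental.MultipleZetaDuality
import Literature.NumberTheory.Transcendental.MultipleZetaShuffleProofs
import HarnessLib

/-!
# Multiple zeta values of weight `5`: the double shuffle relations, `𝒵₅ = ℚ ζ(3,2) + ℚ ζ(2,3)`

Sibling proof file of `Literature.NumberTheory.Transcendental.MultipleZeta` /
`…MultipleZetaValues` (theorems only: no definition, no statement change, no named fact). In the
decreasing convention `ζ(s₁,…,s_k) = ∑_{n₁ > ⋯ > n_k ≥ 1} ∏ nᵢ^{-sᵢ}` of `multipleZeta`, the eight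
admissible indices of weight `5` are `(5), (4,1), (3,2), (2,3), (3,1,1), (2,2,1), (2,1,2), (2,1,1,1)`
(`MZV.eq_of_isAdmissible_of_weight_eq_five`), and this file proves that all eight multiple zeta
values are rational linear combinations of the two **Hoffman elements** `ζ(3,2)`, `ζ(2,3)` of
weight `5` — equivalently of `ζ(5)` and `ζ(2)ζ(3)` (Chmutov–Duzhin–Mostovoy 2012, §10.2.6: up to
weight `12` every MZV "can be written as a rational polynomial in `ζ(2), ζ(3), ζ(5), ζ(7), ζ(2,6),
…`") — from four relations available in the tree:

* the harmonic (stuffle) products `ζ(2)ζ(3) = ζ(2,3) + ζ(3,2) + ζ(5)` and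
  `ζ(2)ζ(2,1) = 2ζ(2,2,1) + ζ(2,1,2) + ζ(2,3) + ζ(4,1)` (Hoffman 1997, Theorem 4.2:
  `multipleZeta_mul`, `MultipleZetaStuffle.lean`), with Euler's `ζ(2,1) = ζ(3)`
  (`euler_zeta_two_one_holds`);
* the shuffle product `ζ(2)ζ(3) = ζ(2,3) + 3ζ(3,2) + 6ζ(4,1)` (Euler's decomposition formula,
  Eie 2013, Theorem 1.2.3: `multipleZeta_two_mul_three_shuffle`, `MultipleZetaShuffleProofs.lean`);
* the duality relations `ζ(3,1,1) = ζ(4,1)`, `ζ(2,2,1) = ζ(3,2)`, `ζ(2,1,2) = ζ(2,3)`,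
  `ζ(2,1,1,1) = ζ(5)` (Hoffman 1992, §5 p. 288–289; `multipleZeta_duality`,
  `MultipleZetaDuality.lean`).

Consequences proved here: Euler's sum formula in weight `5`, `ζ(4,1) + ζ(3,2) + ζ(2,3) = ζ(5)`
(Hoffman 1992, §3 p. 281, the case `k = 2`, `n = 5` of the sum conjecture, "proved in Euler's
paper"; Chmutov–Duzhin–Mostovoy 2012, (10.15)); Euler's evaluations
`ζ(4,1) = 2ζ(5) - ζ(2)ζ(3)` (Eie 2013, §0.1: `S_{1,4} = 3ζ(5) - ζ(2)ζ(3)` with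
`S_{1,4} = ζ(4,1) + ζ(5)`), `ζ(3,2) = 3ζ(2)ζ(3) - (11/2)ζ(5)`, `ζ(2,3) = (9/2)ζ(5) - 2ζ(2)ζ(3)`;
in the Hoffman basis `5ζ(5) = 4ζ(3,2) + 6ζ(2,3)`, `5ζ(4,1) = ζ(2,3) - ζ(3,2)`,
`5ζ(2)ζ(3) = 9ζ(3,2) + 11ζ(2,3)`; and the weight spaces
`mzvSpace_five_eq_span_hoffman : 𝒵₅ = ℚζ(3,2) + ℚζ(2,3)`,
`mzvSpace_five_eq_span : 𝒵₅ = ℚζ(5) + ℚζ(2)ζ(3)`, `finrank_mzvSpace_five_le : dim_ℚ 𝒵₅ ≤ 2 = d₅`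
— the first case of the Goncharov–Terasoma bound `dim_ℚ 𝒵_n ≤ d_n` with `d_n > 1`, and the
weight-`5` case of Brown's theorem `hoffmanSpan 5 = mzvSpace 5`
(`MultipleZetaValuesHoffmanProofs.lean`). Equality `dim_ℚ 𝒵₅ = 2` would be the irrationality of
`ζ(5)/(ζ(2)ζ(3))`, which is open.

## References

* M. E. Hoffman, *Multiple harmonic series*, Pacific J. Math. 152 (1992), 275–290: §3 p. 281
  (sum conjecture, depth `2` due to Euler), §5 pp. 288–289 (all relations of weight `5`).
  [Hoffman1992]
* M. E. Hoffman, *The algebra of multiple harmonic series*, J. Algebra 194 (1997), 477–495,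
  Theorem 4.2. [Hoffman1997]
* M. Eie, *The Theory of Multiple Zeta Values with Applications in Combinatorics*, World
  Scientific (2013), §0.1 (Euler's `S_{1,n}`), Theorem 1.2.3 (Euler's decomposition theorem).
  [Eie2013]
* S. Chmutov, S. Duzhin, J. Mostovoy, *Introduction to Vassiliev Knot Invariants*, CUP (2012),
  §10.2.6 (duality table, Euler's relations (10.15)–(10.16), generators up to weight `12`).
  [ChmutovDuzhinMostovoy2012]
-/

noncomputable section

namespace Literature.NumberTheory.Transcendental

/-! ### The harmonic (stuffle) products of weight `5` -/

/-- `ζ(2)ζ(3) = ζ(2,3) + ζ(3,2) + ζ(5)` — the harmonic product `(2) ∗ (3) = (2,3) + (3,2) + (5)`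
(Hoffman 1997, Theorem 4.2; Hoffman 1992, §1 p. 276: `A(i₁,i₂) + A(i₂,i₁) = ζ(i₁)ζ(i₂) - ζ(i₁+i₂)`;
Chmutov–Duzhin–Mostovoy 2012, (10.16)). [cite: Hoffman1997, Theorem 4.2] -/
theorem multipleZeta_two_mul_three_stuffle :
    multipleZeta [2] * multipleZeta [3] =
      multipleZeta [2, 3] + multipleZeta [3, 2] + multipleZeta [5] := by
  rw [multipleZeta_mul (MZV.isAdmissible_singleton_of_two_le le_rfl)
    (MZV.isAdmissible_singleton_of_two_le (by norm_num)),
    show MZV.stuffle [2] [3] = [[2, 3], [3, 2], [5]] by simp [MZV.stuffle]]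
  simp only [List.map_cons, List.map_nil, List.sum_cons, List.sum_nil]
  ring

/-- `ζ(2)ζ(2,1) = 2ζ(2,2,1) + ζ(2,1,2) + ζ(2,3) + ζ(4,1)` — the harmonic product
`(2) ∗ (2,1) = 2(2,2,1) + (2,1,2) + (2,3) + (4,1)` (Hoffman 1997, §1 and Theorem 4.2; the
example in the docstring of `multipleZeta_mul`). [cite: Hoffman1997, Theorem 4.2] -/
theorem multipleZeta_two_mul_two_one_stuffle :
    multipleZeta [2] * multipleZeta [2, 1] =
      2 * multipleZeta [2, 2, 1] + multipleZeta [2, 1, 2] + multipleZeta [2, 3] +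
        multipleZeta [4, 1] := by
  rw [multipleZeta_mul (MZV.isAdmissible_singleton_of_two_le le_rfl)
    (MZV.isAdmissible_pair le_rfl le_rfl),
    show MZV.stuffle [2] [2, 1] = [[2, 2, 1], [2, 2, 1], [2, 1, 2], [2, 3], [4, 1]] by simp [MZV.stuffle]]
  simp only [List.map_cons, List.map_nil, List.sum_cons, List.sum_nil]
  ring

/-! ### The double shuffle relations of weight `5` and their consequences -/

/-- **Euler's sum formula in weight `5`**: `ζ(4,1) + ζ(3,2) + ζ(2,3) = ζ(5)` (Hoffman 1992, §3
p. 281: `A(n-1,1) + A(n-2,2) + ⋯ + A(2,n-2) = ζ(n)`, "proved in Euler's paper", here `n = 5`;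
Chmutov–Duzhin–Mostovoy 2012, (10.15)). Here from the two stuffle products, Euler's
`ζ(2,1) = ζ(3)` and the dualities `ζ(2,2,1) = ζ(3,2)`, `ζ(2,1,2) = ζ(2,3)`.
[cite: Hoffman1992, §3 p. 281 (sum conjecture, k = 2)] -/
theorem multipleZeta_sum_formula_weight_five :
    multipleZeta [4, 1] + multipleZeta [3, 2] + multipleZeta [2, 3] = multipleZeta [5] := by
  have hS := multipleZeta_two_mul_three_stuffle
  have hS' := multipleZeta_two_mul_two_one_stuffle
  have hE : multipleZeta [2, 1] = multipleZeta [3] := euler_zeta_two_one_holds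
  rw [hE] at hS'
  have hD1 := multipleZeta_two_two_one_eq_three_two
  have hD2 := multipleZeta_two_one_two_eq_two_three
  linarith

/-- In the Hoffman basis: `5 ζ(4,1) = ζ(2,3) - ζ(3,2)` (from the double shuffle relation
`ζ(2,3) + ζ(3,2) + ζ(5) = ζ(2)ζ(3) = ζ(2,3) + 3ζ(3,2) + 6ζ(4,1)` and the sum formula).
[cite: Hoffman1992, §5 pp. 288–289] -/
theorem five_mul_multipleZeta_four_one :
    5 * multipleZeta [4, 1] = multipleZeta [2, 3] - multipleZeta [3, 2] := by
  have hS := multipleZeta_two_mul_three_stuffle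
  have hSh := multipleZeta_two_mul_three_shuffle
  have hsum := multipleZeta_sum_formula_weight_five
  linarith

/-- In the Hoffman basis: `5 ζ(5) = 4 ζ(3,2) + 6 ζ(2,3)`, i.e. `ζ(5) = (4/5)ζ(3,2) + (6/5)ζ(2,3)`
— the depth-one zeta value of weight `5` as a rational combination of the Hoffman elements
(Hoffman's conjecture / Brown's theorem in weight `5`). [cite: Hoffman1992, §5 pp. 288–289] -/
theorem five_mul_multipleZeta_five :
    5 * multipleZeta [5] = 4 * multipleZeta [3, 2] + 6 * multipleZeta [2, 3] := by
  have h41 := five_mul_multipleZeta_four_one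
  have hsum := multipleZeta_sum_formula_weight_five
  linarith

/-- In the Hoffman basis: `5 ζ(2)ζ(3) = 9 ζ(3,2) + 11 ζ(2,3)`. [cite: Hoffman1992, §5 pp. 288–289] -/
theorem five_mul_multipleZeta_two_mul_three :
    5 * (multipleZeta [2] * multipleZeta [3]) = 9 * multipleZeta [3, 2] + 11 * multipleZeta [2, 3] := by
  have hS := multipleZeta_two_mul_three_stuffle
  have h5 := five_mul_multipleZeta_five
  linarith

/-- **Euler's evaluation** `ζ(4,1) = 2ζ(5) - ζ(2)ζ(3)` (Euler 1775; Eie 2013, §0.1: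
`S_{1,n} = (n/2 + 1)ζ(n+1) - ½ ∑_{r=2}^{n-1} ζ(r)ζ(n+1-r)` with `S_{1,4} = ζ(4,1) + ζ(5)`).
[cite: Eie2013, §0.1] -/
theorem multipleZeta_four_one_eq :
    multipleZeta [4, 1] = 2 * multipleZeta [5] - multipleZeta [2] * multipleZeta [3] := by
  have h41 := five_mul_multipleZeta_four_one
  have h5 := five_mul_multipleZeta_five
  have hP := five_mul_multipleZeta_two_mul_three
  linarith

/-- `ζ(3,2) = 3ζ(2)ζ(3) - (11/2)ζ(5)` (the double shuffle relations of weight `5`).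
[cite: ChmutovDuzhinMostovoy2012, §10.2.6] -/
theorem multipleZeta_three_two_eq :
    multipleZeta [3, 2] = 3 * (multipleZeta [2] * multipleZeta [3]) - 11 / 2 * multipleZeta [5] := by
  have h5 := five_mul_multipleZeta_five
  have hP := five_mul_multipleZeta_two_mul_three
  linarith

/-- `ζ(2,3) = (9/2)ζ(5) - 2ζ(2)ζ(3)` (the double shuffle relations of weight `5`).
[cite: ChmutovDuzhinMostovoy2012, §10.2.6] -/
theorem multipleZeta_two_three_eq :
    multipleZeta [2, 3] = 9 / 2 * multipleZeta [5] - 2 * (multipleZeta [2] * multipleZeta [3]) := by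
  have h5 := five_mul_multipleZeta_five
  have hP := five_mul_multipleZeta_two_mul_three
  linarith

/-! ### The admissible indices of weight `5` -/

/-- The admissible indices of weight `5` are `(5)`, `(4,1)`, `(3,2)`, `(2,3)`, `(3,1,1)`, `(2,2,1)`,
`(2,1,2)` and `(2,1,1,1)`. [folklore] -/
theorem MZV.eq_of_isAdmissible_of_weight_eq_five {s : List ℕ} (hs : MZV.IsAdmissible s)
    (hw : MZV.weight s = 5) :
    s = [5] ∨ s = [4, 1] ∨ s = [3, 2] ∨ s = [2, 3] ∨ s = [3, 1, 1] ∨ s = [2, 2, 1] ∨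
      s = [2, 1, 2] ∨ s = [2, 1, 1, 1] := by
  match s, hs, hw with
  | [], _, hw => simp [MZV.weight] at hw
  | [a], _, hw =>
    simp only [MZV.weight, List.sum_cons, List.sum_nil, Nat.add_zero] at hw
    subst hw
    simp
  | [a, b], hs, hw =>
    have ha : 2 ≤ a := by simpa using hs.2 (by simp)
    have hb : 1 ≤ b := hs.1 b (by simp)
    simp only [MZV.weight, List.sum_cons, List.sum_nil, Nat.add_zero] at hw
    rcases (show (a = 4 ∧ b = 1) ∨ (a = 3 ∧ b = 2) ∨ (a = 2 ∧ b = 3) by omega) with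
      ⟨rfl, rfl⟩ | ⟨rfl, rfl⟩ | ⟨rfl, rfl⟩ <;> simp
  | [a, b, c], hs, hw =>
    have ha : 2 ≤ a := by simpa using hs.2 (by simp)
    have hb : 1 ≤ b := hs.1 b (by simp)
    have hc : 1 ≤ c := hs.1 c (by simp)
    simp only [MZV.weight, List.sum_cons, List.sum_nil, Nat.add_zero] at hw
    rcases (show (a = 3 ∧ b = 1 ∧ c = 1) ∨ (a = 2 ∧ b = 2 ∧ c = 1) ∨ (a = 2 ∧ b = 1 ∧ c = 2) by
      omega) with ⟨rfl, rfl, rfl⟩ | ⟨rfl, rfl, rfl⟩ | ⟨rfl, rfl, rfl⟩ <;> simp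
  | [a, b, c, d], hs, hw =>
    have ha : 2 ≤ a := by simpa using hs.2 (by simp)
    have hb : 1 ≤ b := hs.1 b (by simp)
    have hc : 1 ≤ c := hs.1 c (by simp)
    have hd : 1 ≤ d := hs.1 d (by simp)
    simp only [MZV.weight, List.sum_cons, List.sum_nil, Nat.add_zero] at hw
    obtain rfl : a = 2 := by omega
    obtain rfl : b = 1 := by omega
    obtain rfl : c = 1 := by omega
    obtain rfl : d = 1 := by omega
    simp
  | a :: b :: c :: d :: e :: t, hs, hw =>
    exfalso
    have ha : 2 ≤ a := by simpa using hs.2 (by simp)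
    have hb : 1 ≤ b := hs.1 b (by simp)
    have hc : 1 ≤ c := hs.1 c (by simp)
    have hd : 1 ≤ d := hs.1 d (by simp)
    have he : 1 ≤ e := hs.1 e (by simp)
    simp only [MZV.weight, List.sum_cons] at hw
    omega

/-! ### The weight space `𝒵₅` -/

/-- A real number of the form `a u + b v` with `a, b ∈ ℚ` lies in the `ℚ`-span of `{u, v}`.
[folklore] -/
theorem mem_span_pair_of_eq_rat_mul_add {x u v : ℝ} (a b : ℚ) (h : x = a * u + b * v) :
    x ∈ Submodule.span ℚ {u, v} :=
  Submodule.mem_span_pair.2 ⟨a, b, by rw [h, Rat.smul_def, Rat.smul_def]⟩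

/-- **Hoffman's conjecture in weight `5`**: every multiple zeta value of weight `5` is a rational
linear combination of the Hoffman elements `ζ(3,2)` and `ζ(2,3)`:
`ζ(5) = (4ζ(3,2) + 6ζ(2,3))/5`, `ζ(4,1) = (ζ(2,3) - ζ(3,2))/5`, `ζ(3,1,1) = ζ(4,1)`,
`ζ(2,2,1) = ζ(3,2)`, `ζ(2,1,2) = ζ(2,3)`, `ζ(2,1,1,1) = ζ(5)` (Hoffman 1992, §5: for `n = 5`
"all instances of both conjectures hold"; Brown 2012, Theorem 1.1 in weight `5`).
[cite: Hoffman1992, §5 pp. 288–289] -/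
theorem multipleZeta_mem_span_hoffman_of_weight_five {s : List ℕ} (hs : MZV.IsAdmissible s)
    (hw : MZV.weight s = 5) :
    multipleZeta s ∈ Submodule.span ℚ {multipleZeta [3, 2], multipleZeta [2, 3]} := by
  have h5 := five_mul_multipleZeta_five
  have h41 := five_mul_multipleZeta_four_one
  rcases MZV.eq_of_isAdmissible_of_weight_eq_five hs hw with
    rfl | rfl | rfl | rfl | rfl | rfl | rfl | rfl
  · exact mem_span_pair_of_eq_rat_mul_add (4 / 5) (6 / 5) (by push_cast; linarith)
  · exact mem_span_pair_of_eq_rat_mul_add (-1 / 5) (1 / 5) (by push_cast; linarith)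
  · exact mem_span_pair_of_eq_rat_mul_add 1 0 (by push_cast; ring)
  · exact mem_span_pair_of_eq_rat_mul_add 0 1 (by push_cast; ring)
  · rw [multipleZeta_three_one_one_eq_four_one]
    exact mem_span_pair_of_eq_rat_mul_add (-1 / 5) (1 / 5) (by push_cast; linarith)
  · rw [multipleZeta_two_two_one_eq_three_two]
    exact mem_span_pair_of_eq_rat_mul_add 1 0 (by push_cast; ring)
  · rw [multipleZeta_two_one_two_eq_two_three]
    exact mem_span_pair_of_eq_rat_mul_add 0 1 (by push_cast; ring)
  · rw [multipleZeta_two_one_one_one_eq_five]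
    exact mem_span_pair_of_eq_rat_mul_add (4 / 5) (6 / 5) (by push_cast; linarith)

/-- Every multiple zeta value of weight `5` is a rational linear combination of `ζ(5)` and
`ζ(2)ζ(3)` (Chmutov–Duzhin–Mostovoy 2012, §10.2.6; from the double shuffle relations:
`ζ(4,1) = 2ζ(5) - ζ(2)ζ(3)`, `ζ(3,2) = 3ζ(2)ζ(3) - (11/2)ζ(5)`, `ζ(2,3) = (9/2)ζ(5) - 2ζ(2)ζ(3)`
and duality). [cite: ChmutovDuzhinMostovoy2012, §10.2.6] -/
theorem multipleZeta_mem_span_of_weight_five {s : List ℕ} (hs : MZV.IsAdmissible s)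
    (hw : MZV.weight s = 5) :
    multipleZeta s ∈
      Submodule.span ℚ {multipleZeta [5], multipleZeta [2] * multipleZeta [3]} := by
  have h41 := multipleZeta_four_one_eq
  have h32 := multipleZeta_three_two_eq
  have h23 := multipleZeta_two_three_eq
  rcases MZV.eq_of_isAdmissible_of_weight_eq_five hs hw with
    rfl | rfl | rfl | rfl | rfl | rfl | rfl | rfl
  · exact mem_span_pair_of_eq_rat_mul_add 1 0 (by push_cast; ring)
  · exact mem_span_pair_of_eq_rat_mul_add 2 (-1) (by push_cast; linarith)
  · exact mem_span_pair_of_eq_rat_mul_add (-11 / 2) 3 (by push_cast; linarith)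
  · exact mem_span_pair_of_eq_rat_mul_add (9 / 2) (-2) (by push_cast; linarith)
  · rw [multipleZeta_three_one_one_eq_four_one]
    exact mem_span_pair_of_eq_rat_mul_add 2 (-1) (by push_cast; linarith)
  · rw [multipleZeta_two_two_one_eq_three_two]
    exact mem_span_pair_of_eq_rat_mul_add (-11 / 2) 3 (by push_cast; linarith)
  · rw [multipleZeta_two_one_two_eq_two_three]
    exact mem_span_pair_of_eq_rat_mul_add (9 / 2) (-2) (by push_cast; linarith)
  · rw [multipleZeta_two_one_one_one_eq_five]
    exact mem_span_pair_of_eq_rat_mul_add 1 0 (by push_cast; ring)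

/-- **`𝒵₅ = ℚ ζ(3,2) + ℚ ζ(2,3)`**: the weight-`5` multiple zeta values span exactly the
`ℚ`-span of the two Hoffman elements of weight `5` (Hoffman's conjecture / Brown's theorem in
weight `5`, elementary there: Hoffman 1992, §5). [cite: Hoffman1992, §5 pp. 288–289] -/
theorem mzvSpace_five_eq_span_hoffman :
    mzvSpace 5 = Submodule.span ℚ {multipleZeta [3, 2], multipleZeta [2, 3]} := by
  apply le_antisymm
  · rw [mzvSpace, Submodule.span_le]
    rintro x ⟨s, hs, hw, rfl⟩
    exact multipleZeta_mem_span_hoffman_of_weight_five hs hw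
  · rw [Submodule.span_le]
    rintro x hx
    rcases hx with rfl | rfl
    · exact Submodule.subset_span ⟨[3, 2], MZV.isAdmissible_pair (by norm_num) (by norm_num), rfl, rfl⟩
    · exact Submodule.subset_span ⟨[2, 3], MZV.isAdmissible_pair le_rfl (by norm_num), rfl, rfl⟩

/-- `ζ(2)ζ(3) ∈ 𝒵₅` (`= ζ(2,3) + ζ(3,2) + ζ(5)`; an instance of `𝒵₂ · 𝒵₃ ⊆ 𝒵₅`).
[cite: Hoffman1997, Theorem 4.2] -/
theorem multipleZeta_two_mul_three_mem_mzvSpace_five :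
    multipleZeta [2] * multipleZeta [3] ∈ mzvSpace 5 := by
  rw [multipleZeta_two_mul_three_stuffle]
  refine Submodule.add_mem _ (Submodule.add_mem _ ?_ ?_) ?_
  · exact Submodule.subset_span ⟨[2, 3], MZV.isAdmissible_pair le_rfl (by norm_num), rfl, rfl⟩
  · exact Submodule.subset_span ⟨[3, 2], MZV.isAdmissible_pair (by norm_num) (by norm_num), rfl, rfl⟩
  · exact Submodule.subset_span ⟨[5], MZV.isAdmissible_singleton_of_two_le (by norm_num), rfl, rfl⟩

/-- **`𝒵₅ = ℚ ζ(5) + ℚ ζ(2)ζ(3)`** (Chmutov–Duzhin–Mostovoy 2012, §10.2.6: every MZV of weight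
`≤ 12` is a rational polynomial in `ζ(2), ζ(3), ζ(5), ζ(7), ζ(2,6), …`; in weight `5` the monomials
are `ζ(5)` and `ζ(2)ζ(3)`). [cite: ChmutovDuzhinMostovoy2012, §10.2.6] -/
theorem mzvSpace_five_eq_span :
    mzvSpace 5 = Submodule.span ℚ {multipleZeta [5], multipleZeta [2] * multipleZeta [3]} := by
  apply le_antisymm
  · rw [mzvSpace, Submodule.span_le]
    rintro x ⟨s, hs, hw, rfl⟩
    exact multipleZeta_mem_span_of_weight_five hs hw
  · rw [Submodule.span_le]
    rintro x hx
    rcases hx with rfl | rfl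
    · exact Submodule.subset_span ⟨[5], MZV.isAdmissible_singleton_of_two_le (by norm_num), rfl, rfl⟩
    · exact multipleZeta_two_mul_three_mem_mzvSpace_five

/-- **`dim_ℚ 𝒵₅ ≤ 2 = d₅`**: the Goncharov–Terasoma / Deligne–Goncharov bound
`dim_ℚ 𝒵_n ≤ d_n` (named fact `finrank_mzvSpace_le_zagierDim`) in weight `5`, the first weight
with `d_n > 1`, unconditionally and elementarily (`𝒵₅` is spanned by two elements). Equality is
open (it is the irrationality of `ζ(5) / (ζ(2)ζ(3))`). [cite: ChmutovDuzhinMostovoy2012, §10.2.6] -/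
theorem finrank_mzvSpace_five_le : Module.finrank ℚ (mzvSpace 5) ≤ 2 := by
  rw [mzvSpace_five_eq_span_hoffman,
    show ({multipleZeta [3, 2], multipleZeta [2, 3]} : Set ℝ) =
      (({multipleZeta [3, 2], multipleZeta [2, 3]} : Finset ℝ) : Set ℝ) by simp]
  exact (finrank_span_finset_le_card _).trans Finset.card_le_two

/-- `dim_ℚ 𝒵₅ ≤ d₅` (`d₅ = 2`). [cite: ChmutovDuzhinMostovoy2012, §10.2.6] -/
theorem finrank_mzvSpace_five_le_zagierDim : Module.finrank ℚ (mzvSpace 5) ≤ zagierDim 5 :=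
  finrank_mzvSpace_five_le

end Literature.NumberTheory.Transcendental
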